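import Summits.Ventures.PercRepro.RankLevelSetFrameQ

/-!
# PercRepro — C-025 at `q = 3`: the open core as ONE named Prop, and the reduction theorem (night-1, gen 0)

`CoreThree` names the hypothesis left open by the induction wrapper `rls_succ_all` (`RankLevelSetFrameQ`): the body of
`C025` at `(p, 3)` for every `p ≥ 5` on the SIMPLE, RANK-`p`, COLOOP-FREE matroids in which every element admits an
`e`-free partition. `c025_three_of_coreThree` is the reduction of record: `CoreThree → ∀ M p, 5 ≤ p → RLS M p 3`, i.e. the
`C025` body at every `(p, 3)`, `p ≥ 5`, on every finite matroid. (`C025UpTo 2` is in the tree; with `CoreThree` the row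
would be `C025UpTo 3`.) Axioms: standard.
-/

open scoped Matroid

namespace PercRepro

/-- **The open core of C-025 at `q = 3`**: the body of `C025` at `(p, 3)`, `p ≥ 5`, for every simple, rank-`p`, coloop-free
finite matroid in which every element `e` admits an `e`-free partition of `E ∖ {e}` (`e` in the closure of neither side). -/
def CoreThree : Prop :=
  ∀ {α : Type} (M : Matroid α) [M.Finite] (p : ℕ), 5 ≤ p →
    (∀ e ∈ M.E, ∀ f ∈ M.E, e ≠ f → M.eRk {e, f} = 2) → M.eRank = (p : ℕ∞) →
    (∀ e, ¬ M.IsColoop e) →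
    (∀ e ∈ M.E, ∃ A ⊆ M.E \ {e}, e ∉ M.closure A ∧ e ∉ M.closure ((M.E \ {e}) \ A)) →
    phiK p 3 * ({A : Set α | A ⊆ M.E ∧ M.eRk A = (p : ℕ∞) ∧ M.eRk (M.E \ A) = ((3 : ℕ) : ℕ∞)}.ncard : ℚ) ≤
      ({A : Set α | A ⊆ M.E ∧ ((3 : ℕ) : ℕ∞) < M.eRk A ∧ M.eRk A < (p : ℕ∞)}.ncard : ℚ)

/-- **The reduction of record**: `CoreThree` gives the `C025` body at every `(p, 3)`, `p ≥ 5`, on every finite matroid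
(`rls_succ_all` at level `3` with Theorem N `c025_two_all` at level `2`). -/
theorem c025_three_of_coreThree (h : CoreThree) {α : Type} (M : Matroid α) [M.Finite] (p : ℕ) (hp : 5 ≤ p) :
    phiK p 3 * ({A : Set α | A ⊆ M.E ∧ M.eRk A = (p : ℕ∞) ∧ M.eRk (M.E \ A) = ((3 : ℕ) : ℕ∞)}.ncard : ℚ) ≤
      ({A : Set α | A ⊆ M.E ∧ ((3 : ℕ) : ℕ∞) < M.eRk A ∧ M.eRk A < (p : ℕ∞)}.ncard : ℚ) :=
  ThmN.c025_three_of_core (fun M _ p hp hs hR hcol hfree => h M p hp hs hR hcol hfree) M p hp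

end PercRepro
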